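import Mathlib
import Summits.Ventures.HodgeRepro2.CyclotomicSeven
import Summits.Ventures.HodgeRepro2.T5CyclicSubfields
import Summits.Ventures.HodgeRepro2.T4Identification

/-!
# CyclotomicSevenSubfields — the subfields of `ℚ(ζ₇)`: the cubic one is `ℚ(ζ₇)⁺`, the quadratic one is imaginary

A bridge between p1's `CyclotomicSeven.lean` (`K7 = ℚ(ζ₇)` is a sextic Galois CM field with cyclic Galois
group) and p3's `T5CyclicSubfields.lean` (a cyclic Galois extension has exactly one intermediate field of each
degree dividing `[E : F]`) / `T4Identification.lean` (`[K⁺ : ℚ] = 3` for a sextic CM field), instantiating the sentence «`F⁺` is the cyclic cubic and `K` the unique quadratic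
subfield, imaginary» of the record (N2.8.2(a)) for the concrete field:

* `finrank_maximalRealSubfield_K7`: `[K7⁺ : ℚ] = 3` (p3's `T4Identification.finrank_maximalRealSubfield_eq_three`
  for sextic CM fields, applied to `K7`; the two-line direct proof from `[K7 : K7⁺] = 2` is `finrank_realSubfield_top`);
* `existsUnique_cubic_K7` / `existsUnique_quadratic_K7`: exactly one intermediate field of degree 3 and
  exactly one of degree 2 (p3's `existsUnique_intermediateField_finrank_eq` with `isCyclic_gal_K7`);
* `maximalRealSubfield_eq_of_finrank_eq_three`: every cubic intermediate field of `K7` IS `K7⁺`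
  (as intermediate fields);
* `exists_not_fixed_of_finrank_eq_two`: the quadratic subfield is imaginary — complex conjugation
  (`galConj K7`, of order 2) moves one of its elements (p3's `exists_not_fixed_of_orderOf_eq_two`).

Not formalised: the explicit generators (`ζ₇ + ζ₇⁻¹` for the cubic field, `√−7` for the quadratic one).
-/

namespace Summit.Ventures.HodgeRepro2.CyclotomicSeven

open NumberField

/-- The maximal real subfield `K7⁺` as an intermediate field of `K7/ℚ`. -/
noncomputable def realSubfield : IntermediateField ℚ K7 :=
  (maximalRealSubfield K7).toIntermediateField fun q => by
    simp [eq_ratCast]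

/-- The underlying subfield of `realSubfield` is `K7⁺`. -/
theorem realSubfield_toSubfield : (realSubfield).toSubfield = maximalRealSubfield K7 := rfl

/-- `[K7 : K7⁺] = 2`. -/
theorem finrank_realSubfield_top : Module.finrank (maximalRealSubfield K7) K7 = 2 :=
  Algebra.IsQuadraticExtension.finrank_eq_two _ _

/-- `[K7⁺ : ℚ] = 3` (p3's theorem for sextic CM fields, instantiated). -/
theorem finrank_maximalRealSubfield_K7 : Module.finrank ℚ (maximalRealSubfield K7) = 3 :=
  T4Identification.finrank_maximalRealSubfield_eq_three K7 finrank_K7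

/-- `[realSubfield : ℚ] = 3`. -/
theorem finrank_realSubfield : Module.finrank ℚ realSubfield = 3 :=
  finrank_maximalRealSubfield_K7

/-- `Gal(K7/ℚ)` is cyclic — as an instance for p3's uniqueness theorems. -/
instance isCyclic_gal_K7_inst : IsCyclic (K7 ≃ₐ[ℚ] K7) :=
  isCyclic_gal_K7

/-- Exactly one intermediate field of `K7/ℚ` has degree 3. -/
theorem existsUnique_cubic_K7 : ∃! K : IntermediateField ℚ K7, Module.finrank ℚ K = 3 :=
  T5CyclicSubfields.existsUnique_intermediateField_finrank_eq (by rw [finrank_K7]; norm_num)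

/-- Exactly one intermediate field of `K7/ℚ` has degree 2. -/
theorem existsUnique_quadratic_K7 : ∃! K : IntermediateField ℚ K7, Module.finrank ℚ K = 2 :=
  T5CyclicSubfields.existsUnique_intermediateField_finrank_eq (by rw [finrank_K7]; norm_num)

/-- Every cubic intermediate field of `K7` is the maximal real subfield `K7⁺`. -/
theorem eq_realSubfield_of_finrank_eq_three (K : IntermediateField ℚ K7)
    (hK : Module.finrank ℚ K = 3) : K = realSubfield :=
  T5CyclicSubfields.IntermediateField.eq_of_finrank_eq_of_isCyclic (by rw [hK, finrank_realSubfield])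

/-- The cubic subfield of `ℚ(ζ₇)` is totally real (it is `K7⁺`): every cubic intermediate field is fixed
pointwise by complex conjugation. -/
theorem galConj_fixed_of_finrank_eq_three (K : IntermediateField ℚ K7)
    (hK : Module.finrank ℚ K = 3) (x : K7) (hx : x ∈ K) : galConj K7 x = x := by
  rw [eq_realSubfield_of_finrank_eq_three K hK] at hx
  have h0 : galConj K7 x = IsCMField.complexConj K7 x := rfl
  rw [h0]
  exact IsCMField.complexConj_apply_eq_self K7 ⟨x, hx⟩

/-- The quadratic subfield of `ℚ(ζ₇)` is imaginary: complex conjugation moves one of its elements. -/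
theorem exists_not_fixed_of_finrank_eq_two (K : IntermediateField ℚ K7)
    (hK : Module.finrank ℚ K = 2) : ∃ x ∈ K, galConj K7 x ≠ x :=
  T5CyclicSubfields.exists_not_fixed_of_orderOf_eq_two finrank_K7 (orderOf_galConj K7) hK

end Summit.Ventures.HodgeRepro2.CyclotomicSeven
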